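import Mathlib
import Literature.NumberTheory.Transcendental.KZCubicalCalculus

/-!
# Crux `TateFamilyKernel` (stmt-KontsevichZagierPeriods-9130), line `Sketch` — stub `stub_faceIntegral`

The divergence identity on the closed unit cube `[0,1]^{N+1}` used by the descent step of the
lead's skeleton for the crux
`Summit.KontsevichZagierPeriods.KontsevichZagierPeriods.Theses.InverseLandau.TateFamilyKernel`:
for finitely many functions `G k` analytic near the cube, with partial derivative `G' k` along the
coordinate `i k` (continuous on the cube),

`∫_{[0,1]^{N+1}} ∑ₖ ∂_{i k} G k = ∑ₖ (∫_{[0,1]^N} G k|_{x_{i k} = 1} − ∫_{[0,1]^N} G k|_{x_{i k} = 0})`.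

Pure real analysis: Mathlib's divergence theorem for the Bochner integral on a box
(`MeasureTheory.integral_divergence_of_hasFDerivAt_off_countable'`), applied for each `k` to the
vector field `G k · e_{i k}`; the partial derivative hypothesis identifies the directional derivative
`fderiv ℝ (G k) w (e_{i k})` with `G' k w` by uniqueness of one-variable derivatives along the
coordinate line `t ↦ Function.update w (i k) t`.
-/

noncomputable section

open MeasureTheory Set MvPolynomial
open Literature.NumberTheory.Transcendental

namespace Summit.KontsevichZagierPeriods.InverseLandau.TateFamilyKernel.Descent

/-- The directional derivative along the basis vector `e_j = Pi.single j 1` of a function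
differentiable at `w` is the derivative at `w j` of its restriction to the coordinate line
`t ↦ Function.update w j t`. [folklore] -/
theorem fderiv_apply_single_eq_of_hasDerivAt_update {N : ℕ} (j : Fin (N + 1))
    {g : (Fin (N + 1) → ℝ) → ℝ} {w : Fin (N + 1) → ℝ} {c : ℝ} (hg : DifferentiableAt ℝ g w)
    (hder : HasDerivAt (fun t : ℝ => g (Function.update w j t)) c (w j)) :
    fderiv ℝ g w (Pi.single j 1) = c := by
  have h1 : HasFDerivAt g (fderiv ℝ g w) (Function.update w j (w j)) := by
    rw [Function.update_eq_self]
    exact hg.hasFDerivAt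
  exact (h1.comp_hasDerivAt (w j) (hasDerivAt_update w j (w j))).unique hder

/-- A face `{x_j = c}` of the box `[0,1]^{N+1} = Icc 0 1`, parametrised by `Fin N → ℝ` through
`Fin.succAbove j`, is the closed unit cube `[0,1]^N`. [folklore] -/
theorem face_eq_cube {N : ℕ} (j : Fin (N + 1)) :
    Icc ((0 : Fin (N + 1) → ℝ) ∘ j.succAbove) ((1 : Fin (N + 1) → ℝ) ∘ j.succAbove) = KZ.cube N := by
  rw [KZ.cube_eq_Icc]
  rfl

/-- **Newton–Leibniz along one coordinate of the cube.** If `g` is analytic near `[0,1]^{N+1}` and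
`g'` is its partial derivative along the coordinate `j` on the cube, continuous there, then
`∫_{[0,1]^{N+1}} g' = ∫_{[0,1]^N} g|_{x_j = 1} − ∫_{[0,1]^N} g|_{x_j = 0}`: the divergence theorem
(`MeasureTheory.integral_divergence_of_hasFDerivAt_off_countable'`) for the vector field `g · e_j`.
[folklore] -/
theorem setIntegral_cube_partialDeriv {N : ℕ} (j : Fin (N + 1)) {g g' : (Fin (N + 1) → ℝ) → ℝ}
    (hg : AnalyticOnNhd ℝ g (KZ.cube (N + 1)))
    (hder : ∀ w ∈ KZ.cube (N + 1),
      HasDerivAt (fun t : ℝ => g (Function.update w j t)) (g' w) (w j))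
    (hg'c : ContinuousOn g' (KZ.cube (N + 1))) :
    ∫ w in KZ.cube (N + 1), g' w =
      (∫ x in KZ.cube N, g (Fin.insertNth j 1 x)) - ∫ x in KZ.cube N, g (Fin.insertNth j 0 x) := by
  classical
  -- the directional derivative along `e_j` is `g'` on the cube
  have hpart : ∀ w ∈ KZ.cube (N + 1), fderiv ℝ g w (Pi.single j 1) = g' w := fun w hw =>
    fderiv_apply_single_eq_of_hasDerivAt_update j (hg w hw).differentiableAt (hder w hw)
  -- the vector field `g · e_j` and its derivative
  obtain ⟨f, hf⟩ : ∃ f : Fin (N + 1) → (Fin (N + 1) → ℝ) → ℝ,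
      f = fun l => if l = j then g else 0 := ⟨_, rfl⟩
  obtain ⟨f', hf'⟩ : ∃ f' : Fin (N + 1) → (Fin (N + 1) → ℝ) → (Fin (N + 1) → ℝ) →L[ℝ] ℝ,
      f' = fun l w => if l = j then fderiv ℝ g w else 0 := ⟨_, rfl⟩
  have hfj : f j = g := by simp [hf]
  have hfl : ∀ l, l ≠ j → f l = 0 := fun l hl => by simp [hf, hl]
  have hdiv : ∀ x, ∑ l, f' l x (Pi.single l 1) = fderiv ℝ g x (Pi.single j 1) := by
    intro x
    rw [Finset.sum_eq_single j]
    · simp [hf']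
    · intro l _ hl
      simp [hf', hl]
    · exact fun h => absurd (Finset.mem_univ j) h
  -- hypotheses of the divergence theorem
  have Hc : ∀ l, ContinuousOn (f l) (Icc 0 1) := by
    intro l
    by_cases hl : l = j
    · subst hl
      rw [hfj, ← KZ.cube_eq_Icc]
      exact hg.continuousOn
    · rw [hfl l hl]
      exact continuousOn_const
  have Hd : ∀ x ∈ (Set.pi univ fun l => Ioo ((0 : Fin (N + 1) → ℝ) l) ((1 : Fin (N + 1) → ℝ) l)) \ ∅,
      ∀ l, HasFDerivAt (f l) (f' l x) x := by
    intro x hx l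
    have hxc : x ∈ KZ.cube (N + 1) := fun m =>
      ⟨((mem_univ_pi.1 hx.1) m).1.le, ((mem_univ_pi.1 hx.1) m).2.le⟩
    by_cases hl : l = j
    · subst hl
      have h' : f' l x = fderiv ℝ g x := by simp [hf']
      rw [hfj, h']
      exact (hg x hxc).differentiableAt.hasFDerivAt
    · have h' : f' l x = 0 := by simp [hf', hl]
      rw [hfl l hl, h']
      exact hasFDerivAt_zero x
  have Hi : IntegrableOn (fun x => ∑ l, f' l x (Pi.single l 1)) (Icc 0 1) := by
    rw [← KZ.cube_eq_Icc]
    exact (hg'c.integrableOn_compact KZ.isCompact_cube).congr_fun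
      (fun x hx => ((hdiv x).trans (hpart x hx)).symm) KZ.measurableSet_cube
  have key := integral_divergence_of_hasFDerivAt_off_countable' (0 : Fin (N + 1) → ℝ) 1 zero_le_one
    f f' ∅ countable_empty Hc Hd Hi
  -- the left-hand side is `∫_{[0,1]^{N+1}} g'`
  have hL : ∫ w in KZ.cube (N + 1), g' w =
      ∫ x in Icc (0 : Fin (N + 1) → ℝ) 1, ∑ l, f' l x (Pi.single l 1) := by
    rw [← KZ.cube_eq_Icc]
    exact setIntegral_congr_fun KZ.measurableSet_cube fun x hx => ((hdiv x).trans (hpart x hx)).symm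
  rw [hL, key, Finset.sum_eq_single j]
  · rw [hfj, face_eq_cube j, Pi.one_apply, Pi.zero_apply]
  · intro l _ hl
    simp [hfl l hl]
  · exact fun h => absurd (Finset.mem_univ j) h

/-- **Divergence identity on the cube** (stub `stub_faceIntegral` of the crux `TateFamilyKernel`,
line `Sketch`). For finitely many functions `G k` analytic near `[0,1]^{N+1}` with partial
derivatives `G' k` along the coordinates `i k`, continuous on the cube,
`∫_{[0,1]^{N+1}} ∑ₖ G' k = ∑ₖ (∫_{[0,1]^N} G k|_{x_{i k} = 1} − ∫_{[0,1]^N} G k|_{x_{i k} = 0})`: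
exchange the finite sum with the integral (each `G' k` is continuous on the compact cube, hence
integrable) and apply Newton–Leibniz along the coordinate `i k` (`setIntegral_cube_partialDeriv`,
Mathlib's divergence theorem on a box) term by term. [cite: KontsevichZagier2001, §1.2] -/
theorem stub_faceIntegral {N : ℕ} {ι : Type*} (s : Finset ι) (i : ι → Fin (N + 1))
    {G G' : ι → (Fin (N + 1) → ℝ) → ℝ}
    (hGa : ∀ k ∈ s, AnalyticOnNhd ℝ (G k) (KZ.cube (N + 1)))
    (hder : ∀ k ∈ s, ∀ w ∈ KZ.cube (N + 1),
      HasDerivAt (fun t : ℝ => G k (Function.update w (i k) t)) (G' k w) (w (i k)))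
    (hG'c : ∀ k ∈ s, ContinuousOn (G' k) (KZ.cube (N + 1))) :
    ∫ w in KZ.cube (N + 1), ∑ k ∈ s, G' k w =
      ∑ k ∈ s, ((∫ x in KZ.cube N, G k (Fin.insertNth (i k) 1 x)) -
        ∫ x in KZ.cube N, G k (Fin.insertNth (i k) 0 x)) := by
  rw [integral_finsetSum s fun k hk => (hG'c k hk).integrableOn_compact KZ.isCompact_cube]
  exact Finset.sum_congr rfl fun k hk =>
    setIntegral_cube_partialDeriv (i k) (hGa k hk) (hder k hk) (hG'c k hk)

end Summit.KontsevichZagierPeriods.InverseLandau.TateFamilyKernel.Descent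

end
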